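import Summits.AtomisticToContinuum.HydrodynamicLimit.Theorems.CollisionIsometryCLTMesoscopicLLNKernels
import Summits.AtomisticToContinuum.HydrodynamicLimit.Theorems.CollisionIsometryCLTMesoscopicLLNTreeBound

/-!
# `LocalGibbsFineScale` (route `BoxDissipativeWeakStrong`), file 2: averaging kernels; the box kernel

Support lemmas for item stmt-AtomisticToContinuum-9905. The fine-scale statement tests the
empirical fields against the **box kernel** `K_ℓ(x, y) = ℓ⁻³ 𝟙[∀ i, ‖yᵢ - xᵢ‖ < ℓ/2]` (indicator of
the open sup-metric ball of radius `ℓ/2` around `x` in `𝕋³ = (ℝ/ℤ)³`, normalised by its Haar volume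
`ℓ³`). The cluster-expansion estimates of the later files only use that `K_ℓ(x, ·)` is a
nonnegative bounded measurable kernel of unit mass supported in a small ball around `x`; this file
proves the elementary consequences of these GENERIC hypotheses (no new definitions are introduced:
the kernel is an explicit argument `g : 𝕋³ → 𝕋³ → ℝ`),

* `abs_integral_kernel_mul_sub_le` (averaging: `|∫ g(x, y) f(y) dy - f(x)| ≤ η` when `f` varies by
  at most `η` on the support), `abs_integral_kernel_mul_le`, `integral_kernel_μ_le` (`∫ g(x,·) dμ ≤ M`),

and then checks them for the box kernel written exactly as in the route statement:
measurability (jointly in `(x, y)`), `0 ≤ K_ℓ ≤ ℓ⁻³`, support `dist y x < ℓ/2`, and **unit mass**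
`∫ K_ℓ(x, y) dy = 1` for `0 < ℓ ≤ 1` (the Haar volume of a ball of radius `r ≤ 1/2` in `ℝ/ℤ` is `2r`:
Mathlib's closed-ball formula and an exhaustion of the open ball by closed balls).
-/

noncomputable section

namespace Summit.AtomisticToContinuum.HydrodynamicLimit.Theorems
namespace LGFS
open MeasureTheory Finset Filter Topology Metric
open Literature.MathematicalPhysics.KineticTheory
open Literature.Analysis.FluidPDE.Torus (euclidDist)
open scoped ENNReal

/-! ### Generic averaging kernels -/

section Generic

variable {g : T3 → ℝ} {C r : ℝ}

/-- A nonnegative kernel bounded by `C` has `|g| ≤ C`. -/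
theorem abs_le_of_nonneg_of_le (hg0 : ∀ y, 0 ≤ g y) (hgC : ∀ y, g y ≤ C) (y : T3) : |g y| ≤ C := by
  rw [abs_of_nonneg (hg0 y)]; exact hgC y

/-- A bounded measurable kernel is integrable (Haar probability measure). -/
theorem integrable_kernel (hg : Measurable g) (hg0 : ∀ y, 0 ≤ g y) (hgC : ∀ y, g y ≤ C) :
    Integrable g :=
  (integrable_const C).mono' hg.aestronglyMeasurable
    (ae_of_all _ fun y => (Real.norm_eq_abs _).le.trans (abs_le_of_nonneg_of_le hg0 hgC y))

/-- A bounded measurable multiple of a bounded measurable kernel is integrable. -/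
theorem integrable_kernel_mul (hg : Measurable g) (hg0 : ∀ y, 0 ≤ g y) (hgC : ∀ y, g y ≤ C)
    {f : T3 → ℝ} (hf : Measurable f) {B : ℝ} (hfB : ∀ y, |f y| ≤ B) :
    Integrable fun y => g y * f y := by
  refine (integrable_const (C * B)).mono' (hg.mul hf).aestronglyMeasurable (ae_of_all _ fun y => ?_)
  rw [Real.norm_eq_abs, abs_mul]
  exact mul_le_mul (abs_le_of_nonneg_of_le hg0 hgC y) (hfB y) (abs_nonneg _) ((hg0 y).trans (hgC y))

/-- **Averaging lemma**: for a kernel `g ≥ 0` of unit mass supported in `{y | dist y x < r}` and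
`f` bounded measurable with `|f y - f x| ≤ η` whenever `dist y x < r`:
`|∫ g(y) f(y) dy - f(x)| ≤ η`. -/
theorem abs_integral_kernel_mul_sub_le (hg : Measurable g) (hg0 : ∀ y, 0 ≤ g y) (hgC : ∀ y, g y ≤ C)
    (hg1 : ∫ y, g y = 1) {x : T3} (hsupp : ∀ y, g y ≠ 0 → dist y x < r) {f : T3 → ℝ}
    (hf : Measurable f) {B : ℝ} (hfB : ∀ y, |f y| ≤ B) {η : ℝ}
    (hmod : ∀ y, dist y x < r → |f y - f x| ≤ η) :
    |(∫ y, g y * f y) - f x| ≤ η := by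
  have hi1 : Integrable fun y => g y * f y := integrable_kernel_mul hg hg0 hgC hf hfB
  have hi2 : Integrable fun y => g y * f x := (integrable_kernel hg hg0 hgC).mul_const _
  have hrepr : (∫ y, g y * f y) - f x = ∫ y, g y * (f y - f x) := by
    have hfx : f x = ∫ y, g y * f x := by rw [integral_mul_const, hg1, one_mul]
    conv_lhs => rw [hfx]
    rw [← integral_sub hi1 hi2]
    refine integral_congr_ae (ae_of_all _ fun y => ?_)
    ring
  rw [hrepr]
  have hη : ∀ y, |g y * (f y - f x)| ≤ g y * η := fun y => by
    rw [abs_mul, abs_of_nonneg (hg0 y)]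
    by_cases hK : g y = 0
    · rw [hK, zero_mul, zero_mul]
    · exact mul_le_mul_of_nonneg_left (hmod y (hsupp y hK)) (hg0 y)
  calc |∫ y, g y * (f y - f x)| ≤ ∫ y, |g y * (f y - f x)| := abs_integral_le_integral_abs
    _ ≤ ∫ y, g y * η :=
        integral_mono_of_nonneg (ae_of_all _ fun y => abs_nonneg _)
          ((integrable_kernel hg hg0 hgC).mul_const η) (ae_of_all _ hη)
    _ = η := by rw [integral_mul_const, hg1, one_mul]

/-- **Weighted mass bound**: `|∫ g(y) f(y) dy| ≤ B` for `|f| ≤ B` and a kernel `g ≥ 0` of unit mass. -/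
theorem abs_integral_kernel_mul_le (hg : Measurable g) (hg0 : ∀ y, 0 ≤ g y) (hgC : ∀ y, g y ≤ C)
    (hg1 : ∫ y, g y = 1) (f : T3 → ℝ) {B : ℝ} (hfB : ∀ y, |f y| ≤ B) : |∫ y, g y * f y| ≤ B := by
  calc |∫ y, g y * f y| ≤ ∫ y, |g y * f y| := abs_integral_le_integral_abs
    _ ≤ ∫ y, g y * B := by
        refine integral_mono_of_nonneg (ae_of_all _ fun y => abs_nonneg _)
          ((integrable_kernel hg hg0 hgC).mul_const B) (ae_of_all _ fun y => ?_)
        dsimp only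
        rw [abs_mul, abs_of_nonneg (hg0 y)]
        exact mul_le_mul_of_nonneg_left (hfB y) (hg0 y)
    _ = B := by rw [integral_mul_const, hg1, one_mul]

/-- **`μ`-mass**: `∫ g dμ ≤ M` for the one-particle law `μ = β dy` of a density profile and a
kernel `g ≥ 0` of unit mass. -/
theorem integral_kernel_μ_le (P : DensityProfile) (hg : Measurable g) (hg0 : ∀ y, 0 ≤ g y)
    (hgC : ∀ y, g y ≤ C) (hg1 : ∫ y, g y = 1) : ∫ y, g y ∂P.μ ≤ P.M := by
  calc ∫ y, g y ∂P.μ ≤ P.M * ∫ y, g y := MesoLLN.integral_μ_le P hg0 (integrable_kernel hg hg0 hgC)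
    _ = P.M := by rw [hg1, mul_one]

/-- `∫ |g| dμ ≤ M` under the same hypotheses. -/
theorem integral_abs_kernel_μ_le (P : DensityProfile) (hg : Measurable g) (hg0 : ∀ y, 0 ≤ g y)
    (hgC : ∀ y, g y ≤ C) (hg1 : ∫ y, g y = 1) : ∫ y, |g y| ∂P.μ ≤ P.M := by
  simp_rw [abs_of_nonneg (hg0 _)]
  exact integral_kernel_μ_le P hg hg0 hgC hg1

/-- `0 ≤ ∫ g dμ` for `g ≥ 0`. -/
theorem integral_kernel_μ_nonneg (P : DensityProfile) (hg0 : ∀ y, 0 ≤ g y) : 0 ≤ ∫ y, g y ∂P.μ :=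
  integral_nonneg hg0

/-- `∫ g dμ = ∫ g β dy`. -/
theorem integral_kernel_μ_eq (P : DensityProfile) (g : T3 → ℝ) : ∫ y, g y ∂P.μ = ∫ y, g y * P.β y := by
  rw [P.integral_μ]
  refine integral_congr_ae (ae_of_all _ fun y => ?_)
  ring

/-- `g² ≤ C g` pointwise for `0 ≤ g ≤ C`, whence `|g²| ≤ C²`. -/
theorem kernel_sq_le (hg0 : ∀ y, 0 ≤ g y) (hgC : ∀ y, g y ≤ C) (y : T3) : g y ^ 2 ≤ C * g y := by
  rw [sq]; exact mul_le_mul_of_nonneg_right (hgC y) (hg0 y)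

end Generic

/-! ### The box kernel of the route statement -/

section Box

/-- The box `{y | ∀ i, ‖yᵢ - xᵢ‖ < ℓ/2}` is the open ball of radius `ℓ/2` of Mathlib's sup distance. -/
theorem boxSet_eq_ball {l : ℝ} (hl : 0 < l) (x : T3) :
    {y' : T3 | ∀ i, ‖y' i - x i‖ < l / 2} = ball x (l / 2) := by
  ext y
  simp only [Set.mem_setOf_eq, mem_ball]
  rw [dist_pi_lt_iff (half_pos hl)]
  simp only [dist_eq_norm]

/-- The joint box relation `{(x, y) | ∀ i, ‖yᵢ - xᵢ‖ < ℓ/2}` is open. -/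
theorem isOpen_boxRel (l : ℝ) : IsOpen {p : T3 × T3 | ∀ i, ‖p.2 i - p.1 i‖ < l / 2} := by
  have : {p : T3 × T3 | ∀ i, ‖p.2 i - p.1 i‖ < l / 2} = ⋂ i, {p : T3 × T3 | ‖p.2 i - p.1 i‖ < l / 2} := by
    ext p; simp
  rw [this]
  exact isOpen_iInter_of_finite fun i => isOpen_lt (by fun_prop) continuous_const

/-- **The box kernel is jointly measurable in `(x, y)`.** -/
theorem measurable_boxK_uncurry (l : ℝ) :
    Measurable fun p : T3 × T3 =>
      Set.indicator {y' : T3 | ∀ i, ‖y' i - p.1 i‖ < l / 2} (fun _ => (l ^ 3)⁻¹) p.2 := by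
  have h : (fun p : T3 × T3 =>
      Set.indicator {y' : T3 | ∀ i, ‖y' i - p.1 i‖ < l / 2} (fun _ => (l ^ 3)⁻¹) p.2) =
      {p : T3 × T3 | ∀ i, ‖p.2 i - p.1 i‖ < l / 2}.indicator fun _ => (l ^ 3)⁻¹ := by
    funext p
    by_cases hp : ∀ i, ‖p.2 i - p.1 i‖ < l / 2
    · rw [Set.indicator_of_mem (show p.2 ∈ {y' : T3 | ∀ i, ‖y' i - p.1 i‖ < l / 2} from hp),
        Set.indicator_of_mem (show p ∈ {p : T3 × T3 | ∀ i, ‖p.2 i - p.1 i‖ < l / 2} from hp)]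
    · rw [Set.indicator_of_notMem (show p.2 ∉ {y' : T3 | ∀ i, ‖y' i - p.1 i‖ < l / 2} from hp),
        Set.indicator_of_notMem (show p ∉ {p : T3 × T3 | ∀ i, ‖p.2 i - p.1 i‖ < l / 2} from hp)]
  rw [h]
  exact measurable_const.indicator (isOpen_boxRel l).measurableSet

/-- The box kernel is measurable in `y`. -/
theorem measurable_boxK_right (l : ℝ) (x : T3) :
    Measurable fun y : T3 => Set.indicator {y' : T3 | ∀ i, ‖y' i - x i‖ < l / 2} (fun _ => (l ^ 3)⁻¹) y := by
  have h : (fun y : T3 => Set.indicator {y' : T3 | ∀ i, ‖y' i - x i‖ < l / 2} (fun _ => (l ^ 3)⁻¹) y) =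
      (fun p : T3 × T3 => Set.indicator {y' : T3 | ∀ i, ‖y' i - p.1 i‖ < l / 2} (fun _ => (l ^ 3)⁻¹) p.2) ∘
        fun y => (x, y) := rfl
  rw [h]
  exact (measurable_boxK_uncurry l).comp (measurable_const.prodMk measurable_id)

/-- `0 ≤ K_ℓ` for `0 ≤ ℓ`. -/
theorem boxK_nonneg {l : ℝ} (hl : 0 ≤ l) (x y : T3) :
    0 ≤ Set.indicator {y' : T3 | ∀ i, ‖y' i - x i‖ < l / 2} (fun _ => (l ^ 3)⁻¹) y :=
  Set.indicator_nonneg (fun _ _ => inv_nonneg.2 (pow_nonneg hl 3)) _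

/-- `K_ℓ ≤ ℓ⁻³` for `0 ≤ ℓ`. -/
theorem boxK_le {l : ℝ} (hl : 0 ≤ l) (x y : T3) :
    Set.indicator {y' : T3 | ∀ i, ‖y' i - x i‖ < l / 2} (fun _ => (l ^ 3)⁻¹) y ≤ (l ^ 3)⁻¹ :=
  Set.indicator_le_self' (fun _ _ => inv_nonneg.2 (pow_nonneg hl 3)) _

/-- **Support**: where `K_ℓ(x, y) ≠ 0` the sup distance of `y` to `x` is `< ℓ/2`. -/
theorem dist_lt_of_boxK_ne_zero {l : ℝ} (hl : 0 < l) {x y : T3}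
    (h : Set.indicator {y' : T3 | ∀ i, ‖y' i - x i‖ < l / 2} (fun _ => (l ^ 3)⁻¹) y ≠ 0) :
    dist y x < l / 2 := by
  by_cases hy : y ∈ {y' : T3 | ∀ i, ‖y' i - x i‖ < l / 2}
  · rwa [boxSet_eq_ball hl, mem_ball] at hy
  · exact absurd (Set.indicator_of_notMem hy _) h

/-- **Sup distance versus minimal-image distance**: `euclidDist y x ≤ √3 dist y x < 2 dist y x`
(when `y ≠ x`); in particular `dist y x < ℓ/2` forces `euclidDist y x < ℓ`. -/
theorem euclidDist_lt_of_dist_lt {l : ℝ} {x y : T3} (hd : dist y x < l / 2) : euclidDist y x < l := by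
  have hl : 0 < l := by linarith [dist_nonneg (x := y) (y := x)]
  have h3 : Real.sqrt 3 < 2 := by
    rw [show (2 : ℝ) = Real.sqrt 4 by rw [show (4 : ℝ) = 2 ^ 2 by norm_num, Real.sqrt_sq zero_le_two]]
    exact Real.sqrt_lt_sqrt (by norm_num) (by norm_num)
  have hE := Literature.Analysis.FluidPDE.Torus.euclidDist_le_holds y x
  rw [Fintype.card_fin, Nat.cast_ofNat, ← dist_eq_norm] at hE
  calc euclidDist y x ≤ Real.sqrt 3 * dist y x := hE
    _ ≤ Real.sqrt 3 * (l / 2) := mul_le_mul_of_nonneg_left hd.le (Real.sqrt_nonneg _)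
    _ < 2 * (l / 2) := mul_lt_mul_of_pos_right h3 (half_pos hl)
    _ = l := by ring

/-- **The Haar volume of an open ball of radius `0 < r ≤ 1/2` in `ℝ/ℤ` is `2r`** (Mathlib has the
closed ball; exhaust the open ball by closed balls of radii `r n/(n+1)`). -/
theorem volume_ball_unitAddCircle {r : ℝ} (hr : 0 < r) (hr1 : 2 * r ≤ 1) (c : UnitAddCircle) :
    volume (ball c r) = ENNReal.ofReal (2 * r) := by
  apply le_antisymm
  · calc volume (ball c r) ≤ volume (closedBall c r) := measure_mono ball_subset_closedBall
      _ = ENNReal.ofReal (min 1 (2 * r)) := AddCircle.volume_closedBall 1 r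
      _ = ENNReal.ofReal (2 * r) := by rw [min_eq_right hr1]
  · set f : ℕ → ℝ := fun n => r * ((n : ℝ) / ((n : ℝ) + 1)) with hf
    have hf_lt : ∀ n, f n < r := fun n => by
      rw [hf]; dsimp only
      have h1 : (n : ℝ) / ((n : ℝ) + 1) < 1 := (div_lt_one (by positivity)).2 (lt_add_one _)
      exact mul_lt_of_lt_one_right hr h1
    have hle : ∀ n, ENNReal.ofReal (min 1 (2 * f n)) ≤ volume (ball c r) := fun n => by
      rw [← AddCircle.volume_closedBall 1 (f n)]
      exact measure_mono (closedBall_subset_ball (hf_lt n))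
    have hlim : Tendsto (fun n => ENNReal.ofReal (min 1 (2 * f n))) atTop
        (𝓝 (ENNReal.ofReal (2 * r))) := by
      have h1 : Tendsto f atTop (𝓝 r) := by
        have := (tendsto_natCast_div_add_atTop (1 : ℝ)).const_mul r
        rw [mul_one] at this
        exact this
      have h2 : Tendsto (fun n => min 1 (2 * f n)) atTop (𝓝 (min 1 (2 * r))) :=
        tendsto_const_nhds.min (h1.const_mul 2)
      rw [min_eq_right hr1] at h2
      exact ENNReal.tendsto_ofReal h2
    exact le_of_tendsto' hlim hle

/-- **The Haar volume of the box is `ℓ³`** for `0 < ℓ ≤ 1`. -/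
theorem volume_boxSet {l : ℝ} (hl : 0 < l) (hl1 : l ≤ 1) (x : T3) :
    volume {y' : T3 | ∀ i, ‖y' i - x i‖ < l / 2} = ENNReal.ofReal (l ^ 3) := by
  have hpi : {y' : T3 | ∀ i, ‖y' i - x i‖ < l / 2} = Set.pi Set.univ fun i => ball (x i) (l / 2) := by
    ext y
    simp only [Set.mem_setOf_eq, Set.mem_pi, Set.mem_univ, true_implies, mem_ball, dist_eq_norm]
  rw [hpi, volume_pi_pi]
  simp_rw [volume_ball_unitAddCircle (half_pos hl) (by linarith) _]
  rw [Finset.prod_const, Finset.card_univ, Fintype.card_fin, ← ENNReal.ofReal_pow (by linarith)]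
  congr 1; ring

/-- **Unit mass**: `∫ K_ℓ(x, y) dy = 1` for `0 < ℓ ≤ 1`. -/
theorem integral_boxK_right {l : ℝ} (hl : 0 < l) (hl1 : l ≤ 1) (x : T3) :
    ∫ y, Set.indicator {y' : T3 | ∀ i, ‖y' i - x i‖ < l / 2} (fun _ => (l ^ 3)⁻¹) y = 1 := by
  have hmeas : MeasurableSet {y' : T3 | ∀ i, ‖y' i - x i‖ < l / 2} := by
    rw [boxSet_eq_ball hl]; exact measurableSet_ball
  rw [integral_indicator_const _ hmeas, measureReal_def, volume_boxSet hl hl1,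
    ENNReal.toReal_ofReal (pow_nonneg hl.le 3), smul_eq_mul, mul_inv_cancel₀ (pow_ne_zero 3 hl.ne')]

end Box

end LGFS
end Summit.AtomisticToContinuum.HydrodynamicLimit.Theorems
end
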